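import Mathlib.Probability.Moments.Variance
import Mathlib.Probability.Independence.Basic
import Mathlib.Probability.ProbabilityMassFunction.Integrals
import HarnessLib

/-!
# Second-moment sampling bounds for finitely many i.i.d. draws from a discrete distribution

Topic `Probability/Moments`. A small, fully proved toolkit for the probabilistic method with `N`
independent draws `ω₁, …, ω_N` from a probability measure `μ` on a COUNTABLE measurable space with
measurable singletons (e.g. `PMF.toMeasure` of a discrete Gaussian on a lattice), packaged on the
product space `Fin N → α` with `Measure.pi` (`IID.draws μ N`):

* `IID.integral_comp_eval` — each draw has law `μ`;
* `IID.measureReal_sum_le_sub_le` — **Chebyshev lower tail for a sum of bounded i.i.d. terms**: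
  `Pr[∑ⱼ g(ωⱼ) ≤ N E[g] − a] ≤ N M²/(4a²)` for `0 ≤ g ≤ M` (variance by Bhatia–Davis,
  `ProbabilityTheory.variance_le_sub_mul_sub`, additivity `ProbabilityTheory.variance_sum_pi`,
  Chebyshev `ProbabilityTheory.meas_ge_le_variance_div_sq`);
* `IID.measureReal_exists_mem_le` — the union bound `Pr[∃ j, ωⱼ ∈ S] ≤ N μ(S)`;
* `IID.measureReal_le_sum_sq_sub_le` — **Markov for the total squared deviation of finitely many
  bounded sums**: `Pr[θ ≤ ∑ₖ (∑ⱼ hₖ(ωⱼ) − N E[hₖ])²] ≤ N |κ| M²/θ` for `|hₖ| ≤ M` (the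
  second-moment substitute for an `ε`-net/Hoeffding argument when a Frobenius-type statistic is
  controlled, as in Aharonov–Regev 2005, Lemma 6.2);
* `IID.exists_not_mem_of_measureReal_lt_one` — an event of probability `< 1` misses a point;
* `IID.integral_toMeasure_eq_tsum` — expectations under `PMF.toMeasure` as series.

Everything is measurable for free (`measurable_of_countable`). Written for the completeness
argument of the Aharonov–Regev coNP verifier (`Algebra/EuclideanLattices/`, sampling dual lattice
vectors from the discrete Gaussian), but independent of lattices.

## References

* S. Arora, B. Barak, *Computational Complexity: A Modern Approach*, CUP 2009, §A.2 (Markov,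
  Chebyshev, the probabilistic method) — textbook material. [folklore]
* D. Aharonov, O. Regev, *Lattice problems in NP ∩ coNP*, J. ACM 52 (2005), §2.6 and Lemma 6.2
  (where Chernoff–Hoeffding is used; a second-moment bound suffices for a single target point).
-/

noncomputable section

open MeasureTheory ProbabilityTheory
open scoped ENNReal

namespace Literature.Probability.Moments

namespace IID

variable {α : Type*} [MeasurableSpace α] [MeasurableSingletonClass α] [Countable α]
  (μ : Measure α) [IsProbabilityMeasure μ] (N : ℕ)

/-- The law of `N` independent draws from `μ`: the product measure on `Fin N → α`. [folklore] -/
abbrev draws : Measure (Fin N → α) := Measure.pi fun _ : Fin N => μ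

/-- `N` independent draws from a probability measure form a probability measure. [folklore] -/
instance : IsProbabilityMeasure (draws μ N) := by unfold draws; infer_instance

variable {μ N}

omit [MeasurableSingletonClass α] [Countable α] in
/-- Each draw has law `μ`: `E[g(ωⱼ)] = E_μ[g]`. [folklore] -/
theorem integral_comp_eval (g : α → ℝ) (hg : Measurable g) (j : Fin N) :
    ∫ ω, g (ω j) ∂(draws μ N) = ∫ a, g a ∂μ := by
  have h := measurePreserving_eval (fun _ : Fin N => μ) j
  rw [← integral_map (measurable_pi_apply j).aemeasurable hg.aestronglyMeasurable, h.map_eq]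

/-- **Lower deviations of a sum of bounded i.i.d. terms** (Chebyshev with the Bhatia–Davis variance
bound): for `0 ≤ g ≤ M` and `a > 0`,
`Pr[∑ⱼ g(ωⱼ) ≤ N E[g] − a] ≤ N M² / (4a²)`. [folklore] -/
theorem measureReal_sum_le_sub_le {g : α → ℝ} {M : ℝ} (hg0 : ∀ a, 0 ≤ g a) (hgM : ∀ a, g a ≤ M) {a : ℝ}
    (ha : 0 < a) :
    (draws μ N).real {ω | ∑ j, g (ω j) ≤ N * (∫ x, g x ∂μ) - a} ≤ N * M ^ 2 / (4 * a ^ 2) := by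
  have hgm : Measurable g := measurable_of_countable g
  set X : (Fin N → α) → ℝ := ∑ j : Fin N, fun ω ↦ g (ω j) with hX
  have hXapply : ∀ ω, X ω = ∑ j, g (ω j) := fun ω ↦ by simp [hX, Finset.sum_apply]
  -- each term is in `L²`
  have hmem : ∀ j : Fin N, MemLp (fun a : α ↦ g a) 2 μ := fun _ ↦
    memLp_of_bounded (a := 0) (b := M) (Filter.Eventually.of_forall fun x ↦ ⟨hg0 x, hgM x⟩)
      hgm.aestronglyMeasurable 2
  have hXmem : MemLp X 2 (draws μ N) := by
    rw [hX]
    exact memLp_finsetSum' _ fun j _ ↦ (hmem j).comp_measurePreserving (measurePreserving_eval _ j)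
  have hint : ∀ j : Fin N, Integrable (fun ω : Fin N → α ↦ g (ω j)) (draws μ N) := fun j ↦
    ((hmem j).comp_measurePreserving (measurePreserving_eval _ j)).integrable one_le_two
  -- mean and variance of the sum
  have hmean : ∫ ω, X ω ∂(draws μ N) = N * ∫ x, g x ∂μ := by
    simp_rw [hXapply]
    rw [integral_finsetSum _ fun j _ ↦ hint j]
    simp [integral_comp_eval g hgm]
  have hvar : variance X (draws μ N) ≤ N * (M ^ 2 / 4) := by
    rw [hX, variance_sum_pi (X := fun _ a ↦ g a) hmem]
    simp only [Finset.sum_const, Finset.card_univ, Fintype.card_fin, nsmul_eq_mul]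
    gcongr
    have hv := variance_le_sub_mul_sub (μ := μ) (X := g) (a := 0) (b := M)
      (Filter.Eventually.of_forall fun x ↦ ⟨hg0 x, hgM x⟩) hgm.aemeasurable
    nlinarith [sq_nonneg (M - 2 * ∫ x, g x ∂μ)]
  -- Chebyshev
  have hcheb := meas_ge_le_variance_div_sq hXmem ha
  have hsub : {ω : Fin N → α | ∑ j, g (ω j) ≤ N * (∫ x, g x ∂μ) - a} ⊆ {ω | a ≤ |X ω - ∫ ω', X ω' ∂(draws μ N)|} := by
    intro ω hω
    simp only [Set.mem_setOf_eq] at hω ⊢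
    rw [hXapply, hmean]
    have : ∑ j, g (ω j) - N * ∫ x, g x ∂μ ≤ -a := by linarith
    calc a ≤ -( ∑ j, g (ω j) - N * ∫ x, g x ∂μ) := by linarith
      _ ≤ |∑ j, g (ω j) - N * ∫ x, g x ∂μ| := neg_le_abs _
  calc (draws μ N).real {ω | ∑ j, g (ω j) ≤ N * (∫ x, g x ∂μ) - a}
      ≤ (draws μ N).real {ω | a ≤ |X ω - ∫ ω', X ω' ∂(draws μ N)|} := measureReal_mono hsub
    _ ≤ variance X (draws μ N) / a ^ 2 := by
        rw [measureReal_def]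
        exact ENNReal.toReal_le_of_le_ofReal (div_nonneg (variance_nonneg _ _) (sq_nonneg _)) hcheb
    _ ≤ N * (M ^ 2 / 4) / a ^ 2 := by gcongr
    _ = N * M ^ 2 / (4 * a ^ 2) := by ring

/-- **Union bound over the draws**: `Pr[∃ j, ωⱼ ∈ S] ≤ N μ(S)`. [folklore] -/
theorem measureReal_exists_mem_le (S : Set α) :
    (draws μ N).real {ω | ∃ j, ω j ∈ S} ≤ N * μ.real S := by
  have hset : {ω : Fin N → α | ∃ j, ω j ∈ S} = ⋃ j : Fin N, (fun ω : Fin N → α ↦ ω j) ⁻¹' S := by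
    ext ω; simp
  rw [hset]
  calc (draws μ N).real (⋃ j : Fin N, (fun ω : Fin N → α ↦ ω j) ⁻¹' S)
      ≤ ∑ j : Fin N, (draws μ N).real ((fun ω : Fin N → α ↦ ω j) ⁻¹' S) := measureReal_iUnion_fintype_le _
    _ = ∑ _j : Fin N, μ.real S := by
        refine Finset.sum_congr rfl fun j _ ↦ ?_
        rw [measureReal_def, measureReal_def, ← Measure.map_apply_of_aemeasurable (measurable_pi_apply j).aemeasurable]
        · rw [(measurePreserving_eval (fun _ : Fin N => μ) j).map_eq]
        · exact (Set.to_countable S).measurableSet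
    _ = N * μ.real S := by simp

/-- **Markov's inequality for the total squared deviation of several bounded sums** (the
second-moment substitute for a net argument): for finitely many bounded statistics `h k`,
`|h k| ≤ M`, and `θ > 0`,
`Pr[θ ≤ ∑ₖ (∑ⱼ h k (ωⱼ) − N E[h k])²] ≤ N |κ| M² / θ` (the expectation of the left statistic is
`∑ₖ Var(∑ⱼ h k (ωⱼ)) = N ∑ₖ Var(h k) ≤ N |κ| M²`). [folklore] -/
theorem measureReal_le_sum_sq_sub_le {κ : Type*} [Fintype κ] {h : κ → α → ℝ} {M : ℝ}
    (hM : ∀ k a, |h k a| ≤ M) {θ : ℝ} (hθ : 0 < θ) :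
    (draws μ N).real {ω | θ ≤ ∑ k, (∑ j, h k (ω j) - N * ∫ x, h k x ∂μ) ^ 2} ≤
      N * Fintype.card κ * M ^ 2 / θ := by
  have hm : ∀ k, Measurable (h k) := fun k ↦ measurable_of_countable _
  have hmem : ∀ k, Fin N → MemLp (fun a ↦ h k a) 2 μ := fun k _ ↦
    memLp_of_bounded (a := -M) (b := M) (Filter.Eventually.of_forall fun x ↦ abs_le.1 (hM k x))
      (hm k).aestronglyMeasurable 2
  set Y : κ → (Fin N → α) → ℝ := fun k ↦ ∑ j : Fin N, fun ω ↦ h k (ω j) with hY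
  have hYapply : ∀ k ω, Y k ω = ∑ j, h k (ω j) := by
    intro k ω; simp [hY, Finset.sum_apply]
  have hYmem : ∀ k, MemLp (Y k) 2 (draws μ N) := fun k ↦
    memLp_finsetSum' _ fun j _ ↦ (hmem k j).comp_measurePreserving (measurePreserving_eval _ j)
  have hint : ∀ k (j : Fin N), Integrable (fun ω : Fin N → α ↦ h k (ω j)) (draws μ N) := fun k j ↦
    ((hmem k j).comp_measurePreserving (measurePreserving_eval _ j)).integrable one_le_two
  have hmean : ∀ k, ∫ ω, Y k ω ∂(draws μ N) = N * ∫ x, h k x ∂μ := by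
    intro k
    simp_rw [hYapply]
    rw [integral_finsetSum _ fun j _ ↦ hint k j]
    simp [integral_comp_eval (h k) (hm k)]
  have hvar : ∀ k, variance (Y k) (draws μ N) ≤ N * M ^ 2 := by
    intro k
    rw [hY, variance_sum_pi (X := fun _ a ↦ h k a) (hmem k)]
    simp only [Finset.sum_const, Finset.card_univ, Fintype.card_fin, nsmul_eq_mul]
    gcongr
    have hv := variance_le_sub_mul_sub (μ := μ) (X := h k) (a := -M) (b := M)
      (Filter.Eventually.of_forall fun x ↦ abs_le.1 (hM k x)) (hm k).aemeasurable
    nlinarith [sq_nonneg (∫ x, h k x ∂μ)]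
  -- the statistic `F` and its expectation
  set F : (Fin N → α) → ℝ := fun ω ↦ ∑ k, (Y k ω - ∫ ω', Y k ω' ∂(draws μ N)) ^ 2 with hF
  have hF0 : 0 ≤ᵐ[draws μ N] F := Filter.Eventually.of_forall fun ω ↦ Finset.sum_nonneg fun k _ ↦ sq_nonneg _
  have hFint_k : ∀ k, Integrable (fun ω ↦ (Y k ω - ∫ ω', Y k ω' ∂(draws μ N)) ^ 2) (draws μ N) := fun k ↦
    ((hYmem k).sub (memLp_const _)).integrable_sq
  have hFint : Integrable F (draws μ N) := integrable_finsetSum _ fun k _ ↦ hFint_k k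
  have hEF : ∫ ω, F ω ∂(draws μ N) = ∑ k, variance (Y k) (draws μ N) := by
    rw [hF, integral_finsetSum _ fun k _ ↦ hFint_k k]
    refine Finset.sum_congr rfl fun k _ ↦ ?_
    rw [variance_eq_integral (hYmem k).aestronglyMeasurable.aemeasurable]
  have hEF' : ∫ ω, F ω ∂(draws μ N) ≤ N * Fintype.card κ * M ^ 2 := by
    rw [hEF]
    calc ∑ k, variance (Y k) (draws μ N) ≤ ∑ _k : κ, (N : ℝ) * M ^ 2 := Finset.sum_le_sum fun k _ ↦ hvar k
      _ = N * Fintype.card κ * M ^ 2 := by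
          simp only [Finset.sum_const, Finset.card_univ, nsmul_eq_mul]; ring
  -- Markov
  have hmarkov := mul_meas_ge_le_integral_of_nonneg hF0 hFint θ
  have hmean' : ∀ k, ∫ ω : Fin N → α, ∑ j, h k (ω j) ∂(draws μ N) = N * ∫ x, h k x ∂μ := fun k ↦ by
    rw [← hmean k]
    exact integral_congr_ae (Filter.Eventually.of_forall fun ω ↦ (hYapply k ω).symm)
  have hset : {ω : Fin N → α | θ ≤ ∑ k, (∑ j, h k (ω j) - N * ∫ x, h k x ∂μ) ^ 2} = {ω | θ ≤ F ω} := by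
    ext ω
    simp only [Set.mem_setOf_eq, hF, hYapply, hmean']
  rw [hset, le_div_iff₀ hθ, mul_comm]
  exact hmarkov.trans hEF'

/-- **Expectations under a probability mass function are series**: `E_P[g] = ∑ₐ P(a) g(a)` for
bounded `g` (Mathlib `PMF.integral_eq_tsum`). [folklore] -/
theorem integral_toMeasure_eq_tsum (P : PMF α) {g : α → ℝ} {M : ℝ} (hg : ∀ a, |g a| ≤ M) :
    ∫ a, g a ∂P.toMeasure = ∑' a, (P a).toReal * g a := by
  have hint : Integrable g P.toMeasure :=
    (memLp_of_bounded (a := -M) (b := M) (Filter.Eventually.of_forall fun x ↦ abs_le.1 (hg x))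
      (measurable_of_countable g).aestronglyMeasurable 1).integrable le_rfl
  rw [PMF.integral_eq_tsum P g hint]
  simp [smul_eq_mul]

omit [MeasurableSingletonClass α] [Countable α] in
/-- **The probabilistic method**: an event of probability `< 1` misses some point. [folklore] -/
theorem exists_not_mem_of_measureReal_lt_one {B : Set (Fin N → α)} (h : (draws μ N).real B < 1) :
    ∃ ω, ω ∉ B := by
  by_contra hall
  push Not at hall
  rw [Set.eq_univ_of_forall hall, probReal_univ] at h
  exact lt_irrefl _ h

end IID

end Literature.Probability.Moments

end
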